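import Literature.Geometry.Symplectic.SelfDualPairComplexStructure
import Literature.Geometry.Symplectic.HondaModelNearSymplectic
import HarnessLib

/-!
# The quaternionic frame of a wedge-orthonormal triple of `2`-forms on `ℝ⁴`

Topic `Literature/Geometry/Symplectic` (groundwork `--supports`
`Literature.Geometry.Symplectic.relNearSymplecticTaubesTubes_exists`; everything here is PROVED,
no named fact is introduced).

Pointwise content of Perutz 2006, Lemma 2.1 (b) (a positive-definite three-plane `H ⊂ Λ²(ℝ⁴)*`
for the wedge pairing is the space of self-dual forms of a conformal structure; Donaldson–
Kronheimer §1.1.7), in the constructive form needed to adapt a chart to the (definite) gradient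
image of a strictly near-symplectic form along its zero set (`NearSymplecticDefinite.lean`):
for a **wedge-orthonormal triple** `η₁, η₂, η₃` (`Pf(η_i) = p ≠ 0`, `η_i ∧ η_j = 0` for
`i ≠ j`; `IsWedgeOrthonormalTriple`) —

* the three complex structures `I₁ = η₃⁻¹η₂`, `I₂ = η₁⁻¹η₃`, `I₃ = η₂⁻¹η₁` of
  `SelfDualPairComplexStructure.lean` satisfy the **quaternion relations** `I₁I₂ = I₃`,
  `I₂I₃ = I₁`, `I₃I₁ = I₂` (`I₁_I₂`, …) and `η₁(I₁·, ·) = η₂(I₂·, ·) = η₃(I₃·, ·)`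
  (`alt₂_I₂_eq`, `alt₃_I₃_eq`: the common symmetric form `−g`);
* for every `x ≠ 0` the vectors `x, I₁x, I₂x, I₃x` are linearly independent
  (`linearIndependent_frame`) and `c(x) = η₁(x, I₁x) ≠ 0` (`frameCoeff_ne_zero`), and in this
  frame the triple is `c(x)` times the STANDARD self-dual triple:
  `η₁ = c (f⁰¹ + f²³)`, `η₂ = c (f⁰² + f³¹)`, `η₃ = c (f⁰³ + f¹²)` (the tables `alt₁_frame`,
  `alt₂_frame`, `alt₃_frame`);
* hence a linear automorphism `A` of `ℝ⁴` with `A e₀ = x` and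
  `η_i(Au, Av) = c(x) · β_i(u, v)` for the standard self-dual forms `β_i = hondaBeta_i` of
  `HondaModelNearSymplectic.lean` (`exists_frame_eq_smul_hondaBeta`): `A^*(span η) = Λ⁺_std`,
  with the first frame vector prescribed.

All proofs are coordinate-free manipulations with the defining identities
`η₃(I₁x, y) = η₂(x, y)`, `η₂(I₁x, y) = −η₃(x, y)` (and cyclic), the polarised adjugate identity,
and non-degeneracy; independence is the quaternion-inverse trick
`(a₀ − Σ aᵢIᵢ)(a₀x + Σ aᵢIᵢx) = |a|² x`.

## References

* T. Perutz, *Zero-sets of near-symplectic forms*, J. Symplectic Geom. 4 (2006), Lemma 2.1 (b)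
  [Perutz2006].
* D. McDuff, D. Salamon, *Introduction to Symplectic Topology*, 3rd ed. (2017), §2.1
  [McDuffSalamon2017].
-/

noncomputable section

open Set Function Module

namespace Literature.Geometry.Symplectic

/-- Local notation for the model space `ℝ⁴ = EuclideanSpace ℝ (Fin 4)`. -/
local notation "E4" => EuclideanSpace ℝ (Fin 4)

/-- Double expansion of a `2`-form against finite combinations of a family `f`:
`β(Σ cᵢ fᵢ, Σ dⱼ fⱼ) = Σᵢ Σⱼ cᵢ dⱼ β(fᵢ, fⱼ)`. [folklore] -/
theorem alt_two_sum_sum (β : E4 [⋀^Fin 2]→L[ℝ] ℝ) (c d : Fin 4 → ℝ) (f : Fin 4 → E4) :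
    β ![∑ i, c i • f i, ∑ j, d j • f j] = ∑ i, ∑ j, c i * d j * β ![f i, f j] := by
  rw [alt_two_sum_smul_left]
  refine Finset.sum_congr rfl fun i _ => ?_
  rw [alt_two_swap, alt_two_sum_smul_left, neg_eq_neg_one_mul, Finset.mul_sum, Finset.mul_sum]
  refine Finset.sum_congr rfl fun j _ => ?_
  rw [alt_two_swap β (f i) (f j)]
  ring

/-! ### Wedge-orthonormal triples and their complex structures -/

/-- **A wedge-orthonormal triple of `2`-forms on `ℝ⁴`**: equal non-zero Pfaffians `p` and
pairwise vanishing wedge pairings — an orthogonal basis, of vectors of equal positive length when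
`p > 0`, of a definite three-plane for the wedge-square form (Perutz 2006, Lemma 2.1 (b)).
[cite: Perutz2006, Lemma 2.1 (b)] -/
structure IsWedgeOrthonormalTriple (η₁ η₂ η₃ : E4 [⋀^Fin 2]→L[ℝ] ℝ) (p : ℝ) : Prop where
  /-- The common Pfaffian is non-zero. -/
  p_ne : p ≠ 0
  /-- `Pf(η₁) = p`. -/
  pf₁ : pfaffian η₁ = p
  /-- `Pf(η₂) = p`. -/
  pf₂ : pfaffian η₂ = p
  /-- `Pf(η₃) = p`. -/
  pf₃ : pfaffian η₃ = p
  /-- `η₁ ∧ η₂ = 0`. -/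
  orth₁₂ : pfaffianPair η₁ η₂ = 0
  /-- `η₁ ∧ η₃ = 0`. -/
  orth₁₃ : pfaffianPair η₁ η₃ = 0
  /-- `η₂ ∧ η₃ = 0`. -/
  orth₂₃ : pfaffianPair η₂ η₃ = 0

variable {η₁ η₂ η₃ : E4 [⋀^Fin 2]→L[ℝ] ℝ} {p : ℝ}

/-- `I₁ = η₃⁻¹η₂`: `η₃(I₁x, y) = η₂(x, y)`. [cite: Perutz2006, Lemma 2.1 (b)] -/
def tripleI₁ (η₂ η₃ : E4 [⋀^Fin 2]→L[ℝ] ℝ) : E4 → E4 := pairComplex η₃ η₂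

/-- `I₂ = η₁⁻¹η₃`: `η₁(I₂x, y) = η₃(x, y)`. [cite: Perutz2006, Lemma 2.1 (b)] -/
def tripleI₂ (η₁ η₃ : E4 [⋀^Fin 2]→L[ℝ] ℝ) : E4 → E4 := pairComplex η₁ η₃

/-- `I₃ = η₂⁻¹η₁`: `η₂(I₃x, y) = η₁(x, y)`. [cite: Perutz2006, Lemma 2.1 (b)] -/
def tripleI₃ (η₁ η₂ : E4 [⋀^Fin 2]→L[ℝ] ℝ) : E4 → E4 := pairComplex η₂ η₁

/-- `I₁` is additive. [folklore] -/
theorem I₁_add (x x' : E4) : tripleI₁ η₂ η₃ (x + x') = tripleI₁ η₂ η₃ x + tripleI₁ η₂ η₃ x' :=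
  pairComplex_add η₃ η₂ x x'

/-- `I₁` is homogeneous. [folklore] -/
theorem I₁_smul (c : ℝ) (x : E4) : tripleI₁ η₂ η₃ (c • x) = c • tripleI₁ η₂ η₃ x :=
  pairComplex_smul η₃ η₂ c x

/-- `I₁ 0 = 0`. [folklore] -/
theorem I₁_zero : tripleI₁ η₂ η₃ 0 = 0 := by simpa using I₁_smul (η₂ := η₂) (η₃ := η₃) 0 0

/-- `I₂` is additive. [folklore] -/
theorem I₂_add (x x' : E4) : tripleI₂ η₁ η₃ (x + x') = tripleI₂ η₁ η₃ x + tripleI₂ η₁ η₃ x' :=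
  pairComplex_add η₁ η₃ x x'

/-- `I₂` is homogeneous. [folklore] -/
theorem I₂_smul (c : ℝ) (x : E4) : tripleI₂ η₁ η₃ (c • x) = c • tripleI₂ η₁ η₃ x :=
  pairComplex_smul η₁ η₃ c x

/-- `I₂ 0 = 0`. [folklore] -/
theorem I₂_zero : tripleI₂ η₁ η₃ 0 = 0 := by simpa using I₂_smul (η₁ := η₁) (η₃ := η₃) 0 0

/-- `I₃` is additive. [folklore] -/
theorem I₃_add (x x' : E4) : tripleI₃ η₁ η₂ (x + x') = tripleI₃ η₁ η₂ x + tripleI₃ η₁ η₂ x' :=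
  pairComplex_add η₂ η₁ x x'

/-- `I₃` is homogeneous. [folklore] -/
theorem I₃_smul (c : ℝ) (x : E4) : tripleI₃ η₁ η₂ (c • x) = c • tripleI₃ η₁ η₂ x :=
  pairComplex_smul η₂ η₁ c x

/-- `I₃ 0 = 0`. [folklore] -/
theorem I₃_zero : tripleI₃ η₁ η₂ 0 = 0 := by simpa using I₃_smul (η₁ := η₁) (η₂ := η₂) 0 0

namespace IsWedgeOrthonormalTriple

/-- Cyclic rotation of a wedge-orthonormal triple. [folklore] -/
theorem rotate (h : IsWedgeOrthonormalTriple η₁ η₂ η₃ p) : IsWedgeOrthonormalTriple η₂ η₃ η₁ p where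
  p_ne := h.p_ne
  pf₁ := h.pf₂
  pf₂ := h.pf₃
  pf₃ := h.pf₁
  orth₁₂ := h.orth₂₃
  orth₁₃ := by rw [pfaffianPair_comm]; exact h.orth₁₂
  orth₂₃ := by rw [pfaffianPair_comm]; exact h.orth₁₃

/-- `Pf(η₁) ≠ 0`. [folklore] -/
theorem pf₁_ne (h : IsWedgeOrthonormalTriple η₁ η₂ η₃ p) : pfaffian η₁ ≠ 0 := h.pf₁ ▸ h.p_ne

/-- `Pf(η₂) ≠ 0`. [folklore] -/
theorem pf₂_ne (h : IsWedgeOrthonormalTriple η₁ η₂ η₃ p) : pfaffian η₂ ≠ 0 := h.pf₂ ▸ h.p_ne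

/-- `Pf(η₃) ≠ 0`. [folklore] -/
theorem pf₃_ne (h : IsWedgeOrthonormalTriple η₁ η₂ η₃ p) : pfaffian η₃ ≠ 0 := h.pf₃ ▸ h.p_ne

/-! ### The defining identities of `I₁` (the others follow by rotation) -/

/-- `η₃(I₁x, y) = η₂(x, y)`. [folklore] -/
theorem alt₃_I₁ (h : IsWedgeOrthonormalTriple η₁ η₂ η₃ p) (x y : E4) :
    η₃ ![tripleI₁ η₂ η₃ x, y] = η₂ ![x, y] :=
  alt_two_pairComplex η₃ η₂ h.pf₃_ne x y

/-- `η₂(I₁x, y) = −η₃(x, y)`. [folklore] -/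
theorem alt₂_I₁ (h : IsWedgeOrthonormalTriple η₁ η₂ η₃ p) (x y : E4) :
    η₂ ![tripleI₁ η₂ η₃ x, y] = -η₃ ![x, y] :=
  alt_two_pairComplex_right η₃ η₂ h.pf₃_ne (h.pf₂.trans h.pf₃.symm)
    (by rw [pfaffianPair_comm]; exact h.orth₂₃) x y

/-- `I₁² = −1`. [folklore] -/
theorem I₁_I₁ (h : IsWedgeOrthonormalTriple η₁ η₂ η₃ p) (x : E4) :
    tripleI₁ η₂ η₃ (tripleI₁ η₂ η₃ x) = -x :=
  pairComplex_pairComplex η₃ η₂ h.pf₃_ne (h.pf₂.trans h.pf₃.symm)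
    (by rw [pfaffianPair_comm]; exact h.orth₂₃) x

/-- `η₁(I₂x, y) = η₃(x, y)`. [folklore] -/
theorem alt₁_I₂ (h : IsWedgeOrthonormalTriple η₁ η₂ η₃ p) (x y : E4) :
    η₁ ![tripleI₂ η₁ η₃ x, y] = η₃ ![x, y] :=
  h.rotate.alt₃_I₁ x y

/-- `η₃(I₂x, y) = −η₁(x, y)`. [folklore] -/
theorem alt₃_I₂ (h : IsWedgeOrthonormalTriple η₁ η₂ η₃ p) (x y : E4) :
    η₃ ![tripleI₂ η₁ η₃ x, y] = -η₁ ![x, y] :=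
  h.rotate.alt₂_I₁ x y

/-- `I₂² = −1`. [folklore] -/
theorem I₂_I₂ (h : IsWedgeOrthonormalTriple η₁ η₂ η₃ p) (x : E4) :
    tripleI₂ η₁ η₃ (tripleI₂ η₁ η₃ x) = -x :=
  h.rotate.I₁_I₁ x

/-- `η₂(I₃x, y) = η₁(x, y)`. [folklore] -/
theorem alt₂_I₃ (h : IsWedgeOrthonormalTriple η₁ η₂ η₃ p) (x y : E4) :
    η₂ ![tripleI₃ η₁ η₂ x, y] = η₁ ![x, y] :=
  h.rotate.rotate.alt₃_I₁ x y

/-- `η₁(I₃x, y) = −η₂(x, y)`. [folklore] -/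
theorem alt₁_I₃ (h : IsWedgeOrthonormalTriple η₁ η₂ η₃ p) (x y : E4) :
    η₁ ![tripleI₃ η₁ η₂ x, y] = -η₂ ![x, y] :=
  h.rotate.rotate.alt₂_I₁ x y

/-- `I₃² = −1`. [folklore] -/
theorem I₃_I₃ (h : IsWedgeOrthonormalTriple η₁ η₂ η₃ p) (x : E4) :
    tripleI₃ η₁ η₂ (tripleI₃ η₁ η₂ x) = -x :=
  h.rotate.rotate.I₁_I₁ x

/-! ### Quaternion relations -/

/-- **`I₁I₂ = I₃`** (test against `η₂`). [cite: Perutz2006, Lemma 2.1 (b)] -/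
theorem I₁_I₂ (h : IsWedgeOrthonormalTriple η₁ η₂ η₃ p) (x : E4) :
    tripleI₁ η₂ η₃ (tripleI₂ η₁ η₃ x) = tripleI₃ η₁ η₂ x := by
  refine eq_of_forall_alt_two_eq η₂ h.pf₂_ne fun y => ?_
  rw [h.alt₂_I₁, h.alt₃_I₂, h.alt₂_I₃, neg_neg]

/-- `I₂I₃ = I₁`. [folklore] -/
theorem I₂_I₃ (h : IsWedgeOrthonormalTriple η₁ η₂ η₃ p) (x : E4) :
    tripleI₂ η₁ η₃ (tripleI₃ η₁ η₂ x) = tripleI₁ η₂ η₃ x :=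
  h.rotate.I₁_I₂ x

/-- `I₃I₁ = I₂`. [folklore] -/
theorem I₃_I₁ (h : IsWedgeOrthonormalTriple η₁ η₂ η₃ p) (x : E4) :
    tripleI₃ η₁ η₂ (tripleI₁ η₂ η₃ x) = tripleI₂ η₁ η₃ x :=
  h.rotate.rotate.I₁_I₂ x

/-- `I₂I₁ = −I₃`. [folklore] -/
theorem I₂_I₁ (h : IsWedgeOrthonormalTriple η₁ η₂ η₃ p) (x : E4) :
    tripleI₂ η₁ η₃ (tripleI₁ η₂ η₃ x) = -tripleI₃ η₁ η₂ x := by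
  rw [← h.I₂_I₃ x, h.I₂_I₂]

/-- `I₃I₂ = −I₁`. [folklore] -/
theorem I₃_I₂ (h : IsWedgeOrthonormalTriple η₁ η₂ η₃ p) (x : E4) :
    tripleI₃ η₁ η₂ (tripleI₂ η₁ η₃ x) = -tripleI₁ η₂ η₃ x :=
  h.rotate.I₂_I₁ x

/-- `I₁I₃ = −I₂`. [folklore] -/
theorem I₁_I₃ (h : IsWedgeOrthonormalTriple η₁ η₂ η₃ p) (x : E4) :
    tripleI₁ η₂ η₃ (tripleI₃ η₁ η₂ x) = -tripleI₂ η₁ η₃ x :=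
  h.rotate.rotate.I₂_I₁ x

/-! ### The common symmetric form `η₁(I₁·, ·) = η₂(I₂·, ·) = η₃(I₃·, ·)` -/

/-- `η₂⁻¹η₃ = −I₁` (`K₂₃ = I₁⁻¹`). [folklore] -/
theorem pairComplex₂₃_eq (h : IsWedgeOrthonormalTriple η₁ η₂ η₃ p) (x : E4) :
    pairComplex η₂ η₃ x = -tripleI₁ η₂ η₃ x := by
  refine eq_of_forall_alt_two_eq η₂ h.pf₂_ne fun y => ?_
  rw [alt_two_pairComplex η₂ η₃ h.pf₂_ne, show -tripleI₁ η₂ η₃ x = (-1 : ℝ) • tripleI₁ η₂ η₃ x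
    by simp, alt_two_smul_left, h.alt₂_I₁]
  ring

/-- **`η₂(I₂x, y) = η₁(I₁x, y)`** (from the polarised adjugate identity for the orthogonal pair
`η₁, η₂`, summed against `η₃(x, e_k)`). [cite: Perutz2006, Lemma 2.1 (b)] -/
theorem alt₂_I₂_eq (h : IsWedgeOrthonormalTriple η₁ η₂ η₃ p) (x y : E4) :
    η₂ ![tripleI₂ η₁ η₃ x, y] = η₁ ![tripleI₁ η₂ η₃ x, y] := by
  -- `η₂(A₁^∨η₃ x, y) = -η₁(A₂^∨η₃ x, y)`
  have e1 : η₂ ![pairMap η₁ η₃ x, y] = -η₁ ![pairMap η₂ η₃ x, y] := by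
    rw [pairMap, pairMap, alt_two_sum_smul_left, alt_two_sum_smul_left, ← Finset.sum_neg_distrib]
    refine Finset.sum_congr rfl fun k _ => ?_
    have hp := alt_two_pfaffAdjCol_polar η₁ η₂ k y
    rw [h.orth₁₂] at hp
    linear_combination (η₃ ![x, stdVec k]) * hp
  -- `pairMap η₁ η₃ = -Pf(η₁) I₂`, `pairMap η₂ η₃ = Pf(η₂) I₁`
  have e2 : pairMap η₁ η₃ x = -pfaffian η₁ • tripleI₂ η₁ η₃ x := by
    rw [tripleI₂, pairComplex, smul_smul, neg_mul_neg, mul_inv_cancel₀ h.pf₁_ne, one_smul]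
  have e3 : pairMap η₂ η₃ x = pfaffian η₂ • tripleI₁ η₂ η₃ x := by
    have h' : pairMap η₂ η₃ x = -pfaffian η₂ • pairComplex η₂ η₃ x := by
      rw [pairComplex, smul_smul, neg_mul_neg, mul_inv_cancel₀ h.pf₂_ne, one_smul]
    rw [h', h.pairComplex₂₃_eq, smul_neg, neg_smul, neg_neg]
  rw [e2, e3, alt_two_smul_left, alt_two_smul_left, h.pf₁, h.pf₂] at e1
  have : p * (η₂ ![tripleI₂ η₁ η₃ x, y] - η₁ ![tripleI₁ η₂ η₃ x, y]) = 0 := by linarith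
  rcases mul_eq_zero.1 this with h0 | h0
  · exact absurd h0 h.p_ne
  · linarith

/-- `η₃(I₃x, y) = η₁(I₁x, y)`. [folklore] -/
theorem alt₃_I₃_eq (h : IsWedgeOrthonormalTriple η₁ η₂ η₃ p) (x y : E4) :
    η₃ ![tripleI₃ η₁ η₂ x, y] = η₁ ![tripleI₁ η₂ η₃ x, y] := by
  rw [← h.alt₂_I₂_eq]; exact h.rotate.alt₂_I₂_eq x y

/-! ### The frame `x, I₁x, I₂x, I₃x` -/

/-- The frame coefficient `c(x) = η₁(x, I₁x)` (`= g(x, x)`). [folklore] -/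
def frameCoeff (η₁ η₂ η₃ : E4 [⋀^Fin 2]→L[ℝ] ℝ) (x : E4) : ℝ :=
  η₁ ![x, tripleI₁ η₂ η₃ x]

/-- The frame `f = (x, I₁x, I₂x, I₃x)`. [folklore] -/
def frame (η₁ η₂ η₃ : E4 [⋀^Fin 2]→L[ℝ] ℝ) (x : E4) : Fin 4 → E4 :=
  ![x, tripleI₁ η₂ η₃ x, tripleI₂ η₁ η₃ x, tripleI₃ η₁ η₂ x]

section Tables

variable (h : IsWedgeOrthonormalTriple η₁ η₂ η₃ p) (x : E4)
include h

/-- **`η₁` in the frame is `c (f⁰¹ + f²³)`**: the six values. [cite: Perutz2006, Lemma 2.1 (b)] -/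
theorem alt₁_frame :
    η₁ ![x, tripleI₁ η₂ η₃ x] = frameCoeff η₁ η₂ η₃ x ∧
    η₁ ![x, tripleI₂ η₁ η₃ x] = 0 ∧ η₁ ![x, tripleI₃ η₁ η₂ x] = 0 ∧
    η₁ ![tripleI₁ η₂ η₃ x, tripleI₂ η₁ η₃ x] = 0 ∧ η₁ ![tripleI₁ η₂ η₃ x, tripleI₃ η₁ η₂ x] = 0 ∧
    η₁ ![tripleI₂ η₁ η₃ x, tripleI₃ η₁ η₂ x] = frameCoeff η₁ η₂ η₃ x := by
  refine ⟨rfl, ?_, ?_, ?_, ?_, ?_⟩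
  · rw [alt_two_swap, h.alt₁_I₂, alt_two_self, neg_zero]
  · rw [alt_two_swap, h.alt₁_I₃, alt_two_self, neg_neg]
  · rw [alt_two_swap, h.alt₁_I₂, alt_two_swap, h.alt₃_I₁, alt_two_self, neg_zero, neg_zero]
  · rw [alt_two_swap, h.alt₁_I₃, neg_neg, alt_two_swap, h.alt₂_I₁, alt_two_self, neg_neg]
  · rw [alt_two_swap, h.alt₁_I₃, neg_neg, alt_two_swap, h.alt₂_I₂_eq,
      alt_two_swap η₁ x (tripleI₁ η₂ η₃ x), neg_neg]
    rfl

/-- **`η₂` in the frame is `c (f⁰² + f³¹)`.** [cite: Perutz2006, Lemma 2.1 (b)] -/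
theorem alt₂_frame :
    η₂ ![x, tripleI₁ η₂ η₃ x] = 0 ∧
    η₂ ![x, tripleI₂ η₁ η₃ x] = frameCoeff η₁ η₂ η₃ x ∧ η₂ ![x, tripleI₃ η₁ η₂ x] = 0 ∧
    η₂ ![tripleI₁ η₂ η₃ x, tripleI₂ η₁ η₃ x] = 0 ∧
    η₂ ![tripleI₁ η₂ η₃ x, tripleI₃ η₁ η₂ x] = -frameCoeff η₁ η₂ η₃ x ∧
    η₂ ![tripleI₂ η₁ η₃ x, tripleI₃ η₁ η₂ x] = 0 := by
  refine ⟨?_, ?_, ?_, ?_, ?_, ?_⟩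
  · rw [alt_two_swap, h.alt₂_I₁, alt_two_self, neg_zero, neg_zero]
  · rw [alt_two_swap, h.alt₂_I₂_eq, alt_two_swap η₁ x (tripleI₁ η₂ η₃ x), neg_neg]
    rfl
  · rw [alt_two_swap, h.alt₂_I₃, alt_two_self, neg_zero]
  · rw [alt_two_swap, h.alt₂_I₂_eq, alt_two_self, neg_zero]
  · rw [alt_two_swap, h.alt₂_I₃]
    rfl
  · rw [h.alt₂_I₂_eq]
    exact (h.alt₁_frame x).2.2.2.2.1

/-- **`η₃` in the frame is `c (f⁰³ + f¹²)`.** [cite: Perutz2006, Lemma 2.1 (b)] -/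
theorem alt₃_frame :
    η₃ ![x, tripleI₁ η₂ η₃ x] = 0 ∧ η₃ ![x, tripleI₂ η₁ η₃ x] = 0 ∧
    η₃ ![x, tripleI₃ η₁ η₂ x] = frameCoeff η₁ η₂ η₃ x ∧
    η₃ ![tripleI₁ η₂ η₃ x, tripleI₂ η₁ η₃ x] = frameCoeff η₁ η₂ η₃ x ∧
    η₃ ![tripleI₁ η₂ η₃ x, tripleI₃ η₁ η₂ x] = 0 ∧
    η₃ ![tripleI₂ η₁ η₃ x, tripleI₃ η₁ η₂ x] = 0 := by
  refine ⟨?_, ?_, ?_, ?_, ?_, ?_⟩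
  · rw [alt_two_swap, h.alt₃_I₁, alt_two_self, neg_zero]
  · rw [alt_two_swap, h.alt₃_I₂, alt_two_self, neg_neg]
  · rw [alt_two_swap, h.alt₃_I₃_eq, alt_two_swap η₁ x (tripleI₁ η₂ η₃ x), neg_neg]
    rfl
  · rw [alt_two_swap, h.alt₃_I₂, neg_neg]
    rfl
  · rw [alt_two_swap, h.alt₃_I₃_eq, alt_two_self, neg_zero]
  · rw [alt_two_swap, h.alt₃_I₃_eq, (h.alt₁_frame x).2.2.2.1, neg_zero]

end Tables

/-! ### Independence of the frame and non-vanishing of `c(x)` -/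

/-- **The frame is linearly independent for `x ≠ 0`** (quaternion-inverse trick:
`(a₀ − Σ aᵢIᵢ)(a₀x + Σ aᵢIᵢx) = |a|² x`). [cite: Perutz2006, Lemma 2.1 (b)] -/
theorem linearIndependent_frame (h : IsWedgeOrthonormalTriple η₁ η₂ η₃ p) {x : E4} (hx : x ≠ 0) :
    LinearIndependent ℝ (frame η₁ η₂ η₃ x) := by
  rw [Fintype.linearIndependent_iff]
  intro a ha
  simp only [frame, Fin.sum_univ_four, Matrix.cons_val_zero, Matrix.cons_val_one,
    Matrix.cons_val] at ha
  -- apply `I₁`, `I₂`, `I₃` to the relation `a₀x + a₁I₁x + a₂I₂x + a₃I₃x = 0`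
  have h1 := congrArg (tripleI₁ η₂ η₃) ha
  rw [I₁_add, I₁_add, I₁_add, I₁_smul, I₁_smul, I₁_smul, I₁_smul, h.I₁_I₁, h.I₁_I₂, h.I₁_I₃,
    I₁_zero] at h1
  have h2 := congrArg (tripleI₂ η₁ η₃) ha
  rw [I₂_add, I₂_add, I₂_add, I₂_smul, I₂_smul, I₂_smul, I₂_smul, h.I₂_I₁, h.I₂_I₂, h.I₂_I₃,
    I₂_zero] at h2
  have h3 := congrArg (tripleI₃ η₁ η₂) ha
  rw [I₃_add, I₃_add, I₃_add, I₃_smul, I₃_smul, I₃_smul, I₃_smul, h.I₃_I₁, h.I₃_I₂, h.I₃_I₃,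
    I₃_zero] at h3
  have key : (a 0 ^ 2 + a 1 ^ 2 + a 2 ^ 2 + a 3 ^ 2) • x = 0 := by
    linear_combination (norm := module) a 0 • ha - a 1 • h1 - a 2 • h2 - a 3 • h3
  have hsum : a 0 ^ 2 + a 1 ^ 2 + a 2 ^ 2 + a 3 ^ 2 = 0 := by
    by_contra hne
    exact hx ((smul_eq_zero.1 key).resolve_left hne)
  have h0 : a 0 = 0 := by nlinarith [sq_nonneg (a 0), sq_nonneg (a 1), sq_nonneg (a 2), sq_nonneg (a 3)]
  have h1' : a 1 = 0 := by nlinarith [sq_nonneg (a 0), sq_nonneg (a 1), sq_nonneg (a 2), sq_nonneg (a 3)]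
  have h2' : a 2 = 0 := by nlinarith [sq_nonneg (a 0), sq_nonneg (a 1), sq_nonneg (a 2), sq_nonneg (a 3)]
  have h3' : a 3 = 0 := by nlinarith [sq_nonneg (a 0), sq_nonneg (a 1), sq_nonneg (a 2), sq_nonneg (a 3)]
  intro i
  fin_cases i <;> assumption

/-- The frame as a basis of `ℝ⁴` (for `x ≠ 0`). [folklore] -/
def frameBasis (h : IsWedgeOrthonormalTriple η₁ η₂ η₃ p) {x : E4} (hx : x ≠ 0) :
    Basis (Fin 4) ℝ E4 :=
  basisOfLinearIndependentOfCardEqFinrank (h.linearIndependent_frame hx)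
    (by rw [Fintype.card_fin, finrank_euclideanSpace_fin])

/-- The frame basis vectors are the frame. [folklore] -/
theorem frameBasis_apply (h : IsWedgeOrthonormalTriple η₁ η₂ η₃ p) {x : E4} (hx : x ≠ 0) (i : Fin 4) :
    h.frameBasis hx i = frame η₁ η₂ η₃ x i := by
  simp [frameBasis]

/-- **`η₁` expanded in the frame**: for `u = Σ aᵢ fᵢ`, `w = Σ bⱼ fⱼ`,
`η₁(u, w) = c (a₀b₁ − a₁b₀ + a₂b₃ − a₃b₂)`. [folklore] -/
theorem alt₁_sum_frame (h : IsWedgeOrthonormalTriple η₁ η₂ η₃ p) (x : E4) (a b : Fin 4 → ℝ) :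
    η₁ ![∑ i, a i • frame η₁ η₂ η₃ x i, ∑ j, b j • frame η₁ η₂ η₃ x j] =
      frameCoeff η₁ η₂ η₃ x * (a 0 * b 1 - b 0 * a 1 + (a 2 * b 3 - b 2 * a 3)) := by
  obtain ⟨v01, v02, v03, v12, v13, v23⟩ := h.alt₁_frame x
  rw [alt_two_sum_sum]
  simp only [Fin.sum_univ_four, frame, Matrix.cons_val_zero, Matrix.cons_val_one,
    Matrix.cons_val, alt_two_self]
  rw [alt_two_swap η₁ x (tripleI₁ η₂ η₃ x), alt_two_swap η₁ x (tripleI₂ η₁ η₃ x),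
    alt_two_swap η₁ x (tripleI₃ η₁ η₂ x),
    alt_two_swap η₁ (tripleI₁ η₂ η₃ x) (tripleI₂ η₁ η₃ x),
    alt_two_swap η₁ (tripleI₁ η₂ η₃ x) (tripleI₃ η₁ η₂ x),
    alt_two_swap η₁ (tripleI₂ η₁ η₃ x) (tripleI₃ η₁ η₂ x), v01, v02, v03, v12, v13, v23]
  ring

/-- **`η₂` expanded in the frame**: `η₂(u, w) = c (a₀b₂ − a₂b₀ + a₃b₁ − a₁b₃)`. [folklore] -/
theorem alt₂_sum_frame (h : IsWedgeOrthonormalTriple η₁ η₂ η₃ p) (x : E4) (a b : Fin 4 → ℝ) :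
    η₂ ![∑ i, a i • frame η₁ η₂ η₃ x i, ∑ j, b j • frame η₁ η₂ η₃ x j] =
      frameCoeff η₁ η₂ η₃ x * (a 0 * b 2 - b 0 * a 2 + (a 3 * b 1 - b 3 * a 1)) := by
  obtain ⟨w01, w02, w03, w12, w13, w23⟩ := h.alt₂_frame x
  rw [alt_two_sum_sum]
  simp only [Fin.sum_univ_four, frame, Matrix.cons_val_zero, Matrix.cons_val_one,
    Matrix.cons_val, alt_two_self]
  rw [alt_two_swap η₂ x (tripleI₁ η₂ η₃ x), alt_two_swap η₂ x (tripleI₂ η₁ η₃ x),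
    alt_two_swap η₂ x (tripleI₃ η₁ η₂ x),
    alt_two_swap η₂ (tripleI₁ η₂ η₃ x) (tripleI₂ η₁ η₃ x),
    alt_two_swap η₂ (tripleI₁ η₂ η₃ x) (tripleI₃ η₁ η₂ x),
    alt_two_swap η₂ (tripleI₂ η₁ η₃ x) (tripleI₃ η₁ η₂ x), w01, w02, w03, w12, w13, w23]
  ring

/-- **`η₃` expanded in the frame**: `η₃(u, w) = c (a₀b₃ − a₃b₀ + a₁b₂ − a₂b₁)`. [folklore] -/
theorem alt₃_sum_frame (h : IsWedgeOrthonormalTriple η₁ η₂ η₃ p) (x : E4) (a b : Fin 4 → ℝ) :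
    η₃ ![∑ i, a i • frame η₁ η₂ η₃ x i, ∑ j, b j • frame η₁ η₂ η₃ x j] =
      frameCoeff η₁ η₂ η₃ x * (a 0 * b 3 - b 0 * a 3 + (a 1 * b 2 - b 1 * a 2)) := by
  obtain ⟨z01, z02, z03, z12, z13, z23⟩ := h.alt₃_frame x
  rw [alt_two_sum_sum]
  simp only [Fin.sum_univ_four, frame, Matrix.cons_val_zero, Matrix.cons_val_one,
    Matrix.cons_val, alt_two_self]
  rw [alt_two_swap η₃ x (tripleI₁ η₂ η₃ x), alt_two_swap η₃ x (tripleI₂ η₁ η₃ x),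
    alt_two_swap η₃ x (tripleI₃ η₁ η₂ x),
    alt_two_swap η₃ (tripleI₁ η₂ η₃ x) (tripleI₂ η₁ η₃ x),
    alt_two_swap η₃ (tripleI₁ η₂ η₃ x) (tripleI₃ η₁ η₂ x),
    alt_two_swap η₃ (tripleI₂ η₁ η₃ x) (tripleI₃ η₁ η₂ x), z01, z02, z03, z12, z13, z23]
  ring

/-- **`c(x) ≠ 0` for `x ≠ 0`**: otherwise `η₁` would vanish on the basis `x, I₁x, I₂x, I₃x`
(the tables), contradicting `Pf(η₁) ≠ 0`. [cite: Perutz2006, Lemma 2.1 (b)] -/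
theorem frameCoeff_ne_zero (h : IsWedgeOrthonormalTriple η₁ η₂ η₃ p) {x : E4} (hx : x ≠ 0) :
    frameCoeff η₁ η₂ η₃ x ≠ 0 := by
  intro hc
  apply h.pf₁_ne
  have hzero : ∀ u w : E4, η₁ ![u, w] = 0 := by
    intro u w
    have hu : u = ∑ i, (h.frameBasis hx).repr u i • frame η₁ η₂ η₃ x i := by
      conv_lhs => rw [← (h.frameBasis hx).sum_repr u]
      simp only [frameBasis_apply]
    have hw : w = ∑ j, (h.frameBasis hx).repr w j • frame η₁ η₂ η₃ x j := by
      conv_lhs => rw [← (h.frameBasis hx).sum_repr w]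
      simp only [frameBasis_apply]
    rw [hu, hw, h.alt₁_sum_frame, hc, zero_mul]
  have : η₁ = 0 := by
    ext v
    have hv : v = ![v 0, v 1] := by funext i; fin_cases i <;> rfl
    rw [hv, hzero]
    rfl
  rw [this, pfaffian_zero]

/-! ### The adapted frame map -/

/-- The frame map `u ↦ Σ uᵢ fᵢ` (sends `eᵢ` to the `i`-th frame vector). [folklore] -/
def frameMap (η₁ η₂ η₃ : E4 [⋀^Fin 2]→L[ℝ] ℝ) (x : E4) : E4 →ₗ[ℝ] E4 where
  toFun u := ∑ i, u i • frame η₁ η₂ η₃ x i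
  map_add' u u' := by
    simp only [PiLp.add_apply, add_smul, Finset.sum_add_distrib]
  map_smul' c u := by
    simp only [PiLp.smul_apply, smul_eq_mul, RingHom.id_apply, Finset.smul_sum, smul_smul]

/-- Unfolding the frame map. [folklore] -/
theorem frameMap_apply (x u : E4) : frameMap η₁ η₂ η₃ x u = ∑ i, u i • frame η₁ η₂ η₃ x i := rfl

/-- The frame map sends `e₀` to `x`. [folklore] -/
theorem frameMap_stdVec_zero (x : E4) : frameMap η₁ η₂ η₃ x (stdVec 0) = x := by
  simp [frameMap_apply, frame]

/-- The frame map is injective for `x ≠ 0`. [folklore] -/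
theorem injective_frameMap (h : IsWedgeOrthonormalTriple η₁ η₂ η₃ p) {x : E4} (hx : x ≠ 0) :
    Injective (frameMap η₁ η₂ η₃ x) := by
  rw [← LinearMap.ker_eq_bot, LinearMap.ker_eq_bot']
  intro u hu
  have hli := Fintype.linearIndependent_iff.1 (h.linearIndependent_frame hx) (fun i => u i) hu
  ext i
  exact hli i

/-- **The adapted frame**: for a wedge-orthonormal triple and `x ≠ 0` there is a linear
automorphism `A` of `ℝ⁴` with `A e₀ = x` pulling the triple back to `c(x)` times the standard
self-dual triple `β₁, β₂, β₃` (`hondaBeta_i`): `η_i(Au, Av) = c(x) β_i(u, v)`, `c(x) ≠ 0`.  This is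
the pointwise form of Perutz 2006, Lemma 2.1 (b) — the span of the triple is `Λ⁺` of the
conformal class of the frame — with the first frame vector prescribed.
[cite: Perutz2006, Lemma 2.1 (b)] -/
theorem exists_frame_eq_smul_hondaBeta (h : IsWedgeOrthonormalTriple η₁ η₂ η₃ p) {x : E4}
    (hx : x ≠ 0) :
    ∃ (A : E4 ≃L[ℝ] E4) (c : ℝ), c ≠ 0 ∧ A (stdVec 0) = x ∧
      (∀ u v, η₁ ![A u, A v] = c * hondaBeta₁ ![u, v]) ∧
      (∀ u v, η₂ ![A u, A v] = c * hondaBeta₂ ![u, v]) ∧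
      (∀ u v, η₃ ![A u, A v] = c * hondaBeta₃ ![u, v]) := by
  set A₀ : E4 ≃ₗ[ℝ] E4 :=
    LinearEquiv.ofInjectiveEndo (frameMap η₁ η₂ η₃ x) (h.injective_frameMap hx) with hA₀
  have hA : ∀ u, A₀ u = ∑ i, u i • frame η₁ η₂ η₃ x i := fun u => by
    rw [hA₀, LinearEquiv.coe_ofInjectiveEndo, frameMap_apply]
  refine ⟨A₀.toContinuousLinearEquiv, frameCoeff η₁ η₂ η₃ x, h.frameCoeff_ne_zero hx, ?_, ?_, ?_, ?_⟩
  · change A₀ (stdVec 0) = x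
    rw [hA]; exact frameMap_stdVec_zero (η₁ := η₁) (η₂ := η₂) (η₃ := η₃) x
  · intro u v
    change η₁ ![A₀ u, A₀ v] = _
    rw [hA, hA, h.alt₁_sum_frame, hondaBeta₁_apply]
  · intro u v
    change η₂ ![A₀ u, A₀ v] = _
    rw [hA, hA, h.alt₂_sum_frame, hondaBeta₂_apply]
  · intro u v
    change η₃ ![A₀ u, A₀ v] = _
    rw [hA, hA, h.alt₃_sum_frame, hondaBeta₃_apply]

end IsWedgeOrthonormalTriple

end Literature.Geometry.Symplectic

end
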